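import Summits.QuantumAdvantage.QuantumAdvantage.Theorems.NearExactIsExact.Negative.SmallCasesWalsh

/-!
# Small cases of `NearExactIsExact` (stmt-QuantumAdvantage-14043), part 2/4: the ANF layer

Monomial blocks of `subsets3 n` (`singles`, `pairs`, `trips`), mask-indexed XORs of monomials (`ixval`, `gfun`,
`cubicF`), the Möbius bridge "every cubic function is a `gfun` of its coefficients" (`gfun_of_cubic`, from the tree's
`truncOf_eq`), the vanishing of cubic Möbius coefficients in degree `≤ 2` (`mcoeff_eq_false_of_deg_two`), the
isolation property `OK78` and the affine strip `Φ(f, b ⊕ ℓ ⊕ g) = (−1)^b Φ(f(·⊕v), g)` (`forrelation_affine`,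
`ok78_affine`).  References: Carlet 2021 §2.2.1; Aaronson–Ambainis 2018 §1.1.1.
-/

set_option linter.dupNamespace false -- D-0017: single-problem summit ⇒ `QuantumAdvantage.QuantumAdvantage` by design

namespace Summit.QuantumAdvantage.QuantumAdvantage.Theorems.NearExactIsExact.Negative.SmallCases

open Finset
open Literature.Computability.QuantumComplexity
open Literature.Computability.QuantumComplexity.DerivativeWalsh (W fsum phi_eq_fsum fsum_eq_sum_mul_W signOf_not)
open Literature.Computability.QuantumComplexity.BuzetChailloux (phi_signOf bxor bxor_comm bxor_bxor_cancel_left)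
open Literature.Computability.QuantumComplexity.Simon (twist_xor_left)
open Summit.QuantumAdvantage.QuantumAdvantage.Theorems.SignedExactSliceIsLift
  (subsets3 indic mcoeff cubicMonomials litVal monoVal evalMonos truncOf)
open Summit.QuantumAdvantage.QuantumAdvantage.Theorems.SignedExactSliceIsLift.StubMoebius
  (isDegLeFun_xor isDegLeFun_and isDegLeFun_all isDegLeFun_litVal bz_foldl_xor sum_map_filter_eq toInput_indic eval_bz
    card_support_le sum_subInd truncOf_eq)
open Summit.QuantumAdvantage.QuantumAdvantage.Theorems.CubicForrelation.NearExactIsExact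
  (bb_exists_dual bb_band_of_dual_degree bb_rmWeight_holds stub_houCubic stub_axParity nf_isDegLeFun_subst)

variable {n : ℕ}




/-! ### Monomial blocks of `subsets3 n` -/

/-- The singletons `[i]`, `i < n`. [cite: Carlet2020, §2.2.1] -/
def singles (n : ℕ) : List (List ℕ) := (List.range n).map fun i => [i]

/-- The increasing pairs `[i, j]`, `i < j < n`. [cite: Carlet2020, §2.2.1] -/
def pairs (n : ℕ) : List (List ℕ) := (List.range n).flatMap fun j => (List.range j).map fun i => [i, j]

/-- The increasing triples `[i, j, l]`, `i < j < l < n`. [cite: Carlet2020, §2.2.1] -/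
def trips (n : ℕ) : List (List ℕ) :=
  (List.range n).flatMap fun l => (List.range l).flatMap fun j => (List.range j).map fun i => [i, j, l]

/-- `subsets3 n` is the concatenation of the four blocks. [cite: Carlet2020, §2.2.1] -/
theorem subsets3_eq (n : ℕ) : subsets3 n = [[]] ++ singles n ++ pairs n ++ trips n := rfl

/-- Shape of a member of `trips n`. [folklore] -/
theorem mem_trips {S : List ℕ} (h : S ∈ trips n) : ∃ i j l, i < j ∧ j < l ∧ l < n ∧ S = [i, j, l] := by
  simp only [trips, List.mem_flatMap, List.mem_map, List.mem_range] at h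
  obtain ⟨l, hl, j, hj, i, hi, rfl⟩ := h
  exact ⟨i, j, l, hi, hj, hl, rfl⟩

/-- Shape of a member of `pairs n`. [folklore] -/
theorem mem_pairs {S : List ℕ} (h : S ∈ pairs n) : ∃ i j, i < j ∧ j < n ∧ S = [i, j] := by
  simp only [pairs, List.mem_flatMap, List.mem_map, List.mem_range] at h
  obtain ⟨j, hj, i, hi, rfl⟩ := h
  exact ⟨i, j, hi, hj, rfl⟩

/-- Shape of a member of `singles n`. [folklore] -/
theorem mem_singles {S : List ℕ} (h : S ∈ singles n) : ∃ i, i < n ∧ S = [i] := by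
  simp only [singles, List.mem_map, List.mem_range] at h
  obtain ⟨i, hi, rfl⟩ := h
  exact ⟨i, hi, rfl⟩

/-! ### Indexed XOR of selected monomials -/

/-- XOR of the monomials of `L` selected by the bits `i, i+1, …` of the mask `M`, at the point `x`.
[cite: Carlet2020, §2.2.1] -/
def ixval (n : ℕ) : List (List ℕ) → ℕ → ℕ → (Fin n → Bool) → Bool
  | [], _, _, _ => false
  | S :: L, i, M, x => xor (M.testBit i && monoVal n S x) (ixval n L (i + 1) M x)

/-- The Boolean function with cubic mask `c`, quadratic mask `q`, linear mask `a` and constant `b`.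
[cite: Carlet2020, §2.2.1] -/
def gfun (n c q a : ℕ) (b : Bool) (x : Fin n → Bool) : Bool :=
  xor (xor (xor b (ixval n (singles n) 0 a x)) (ixval n (pairs n) 0 q x)) (ixval n (trips n) 0 c x)

/-- The cubic form of a mask. [cite: Carlet2020, §2.2.1] -/
def cubicF (n c : ℕ) (x : Fin n → Bool) : Bool := ixval n (trips n) 0 c x

/-- `[a ⊕ b] = [a] + [b]` in `𝔽₂`. [folklore] -/
theorem bz_xor (a b : Bool) : (if xor a b then (1 : ZMod 2) else 0) = (if a then (1 : ZMod 2) else 0) + (if b then 1 else 0) := by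
  cases a <;> cases b <;> decide

/-- `[a ∧ b] = [a]·[b]` in `𝔽₂`. [folklore] -/
theorem bz_and (a b : Bool) : (if (a && b) then (1 : ZMod 2) else 0) = (if a then (1 : ZMod 2) else 0) * (if b then 1 else 0) := by
  cases a <;> cases b <;> decide

/-- Two Booleans with the same `𝔽₂` reading are equal. [folklore] -/
theorem bool_eq_of_bz {a b : Bool} (h : (if a then (1 : ZMod 2) else 0) = (if b then (1 : ZMod 2) else 0)) : a = b := by
  revert h; cases a <;> cases b <;> decide

/-- Shifting the start index is halving the mask. [folklore] -/
theorem ixval_succ (L : List (List ℕ)) : ∀ (i M : ℕ) (x : Fin n → Bool),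
    ixval n L (i + 1) M x = ixval n L i (M / 2) x := by
  induction L with
  | nil => intros; rfl
  | cons S L ih =>
    intro i M x
    show xor (M.testBit (i + 1) && monoVal n S x) (ixval n L (i + 1 + 1) M x) =
      xor ((M / 2).testBit i && monoVal n S x) (ixval n L (i + 1) (M / 2) x)
    rw [ih, Nat.testBit_add_one]

/-- The mask with all bits zero selects nothing. [folklore] -/
theorem ixval_zero (L : List (List ℕ)) : ∀ (i : ℕ) (x : Fin n → Bool), ixval n L i 0 x = false := by
  induction L with
  | nil => intros; rfl
  | cons S L ih => intro i x; show xor (Nat.testBit 0 i && _) _ = false; rw [Nat.zero_testBit, ih]; rfl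

/-- `ixval` is additive in the mask. [folklore] -/
theorem ixval_xor (L : List (List ℕ)) : ∀ (i M N : ℕ) (x : Fin n → Bool),
    ixval n L i (M ^^^ N) x = xor (ixval n L i M x) (ixval n L i N x) := by
  induction L with
  | nil => intros; rfl
  | cons S L ih =>
    intro i M N x
    show xor ((M ^^^ N).testBit i && monoVal n S x) (ixval n L (i + 1) (M ^^^ N) x) =
      xor (xor (M.testBit i && monoVal n S x) (ixval n L (i + 1) M x))
        (xor (N.testBit i && monoVal n S x) (ixval n L (i + 1) N x))
    rw [ih, Nat.testBit_xor]
    cases M.testBit i <;> cases N.testBit i <;> cases monoVal n S x <;>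
      cases ixval n L (i + 1) M x <;> cases ixval n L (i + 1) N x <;> rfl

/-- `cubicF` is additive in the mask. [folklore] -/
theorem cubicF_xor (c d : ℕ) (x : Fin n → Bool) : cubicF n (c ^^^ d) x = xor (cubicF n c x) (cubicF n d x) :=
  ixval_xor _ _ _ _ _

/-- `cubicF 0 = 0`. [folklore] -/
theorem cubicF_zero (x : Fin n → Bool) : cubicF n 0 x = false := ixval_zero _ _ _

/-- The mask of a predicate on a list of monomials: bit `j` is `P L[j]`. [folklore] -/
def maskOf (P : List ℕ → Bool) : List (List ℕ) → ℕ
  | [] => 0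
  | S :: L => (P S).toNat + 2 * maskOf P L

/-- Masks are bounded by `2^{length}`. [folklore] -/
theorem maskOf_lt (P : List ℕ → Bool) : ∀ L : List (List ℕ), maskOf P L < 2 ^ L.length
  | [] => by simp [maskOf]
  | S :: L => by
    have ih := maskOf_lt P L
    have hb : (P S).toNat ≤ 1 := Bool.toNat_le _
    rw [maskOf, List.length_cons, pow_succ]; omega

/-- A predicate false on the whole list has mask `0`. [folklore] -/
theorem maskOf_eq_zero (P : List ℕ → Bool) : ∀ L : List (List ℕ), (∀ S ∈ L, P S = false) → maskOf P L = 0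
  | [], _ => rfl
  | S :: L, h => by
    rw [maskOf, h S List.mem_cons_self, maskOf_eq_zero P L fun T hT => h T (List.mem_cons_of_mem _ hT)]
    rfl

/-- `𝔽₂`-reading of `ixval` on the mask of a predicate: the sum of the selected monomial values. [folklore] -/
theorem bz_ixval_maskOf (P : List ℕ → Bool) (x : Fin n → Bool) : ∀ L : List (List ℕ),
    (if ixval n L 0 (maskOf P L) x then (1 : ZMod 2) else 0) =
      (L.map fun S => (if P S then (1 : ZMod 2) else 0) * (if monoVal n S x then 1 else 0)).sum
  | [] => by simp [ixval]
  | S :: L => by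
    have ih := bz_ixval_maskOf P x L
    have e0 : (maskOf P (S :: L)).testBit 0 = P S := by
      rw [maskOf, Nat.testBit_zero]; cases P S <;> simp [Nat.add_mod]
    have e1 : maskOf P (S :: L) / 2 = maskOf P L := by
      have hb : (P S).toNat ≤ 1 := Bool.toNat_le _
      rw [maskOf]; omega
    show (if xor ((maskOf P (S :: L)).testBit 0 && monoVal n S x) (ixval n L (0 + 1) (maskOf P (S :: L)) x)
      then (1 : ZMod 2) else 0) = _
    rw [ixval_succ, e0, e1, bz_xor, bz_and, ih, List.map_cons, List.sum_cons]

/-! ### The Möbius bridge: every cubic function is a `gfun` -/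

/-- `𝔽₂`-reading of `evalMonos` on a filtered list. [folklore] -/
theorem bz_evalMonos_filter (P : List ℕ → Bool) (L : List (List ℕ)) (x : Fin n → Bool) :
    (if evalMonos n (L.filter P) x then (1 : ZMod 2) else 0) =
      (L.map fun S => (if P S then (1 : ZMod 2) else 0) * (if monoVal n S x then 1 else 0)).sum := by
  rw [evalMonos, bz_foldl_xor, sum_map_filter_eq]
  simp

/-- The binary Möbius coefficients of `g`, as a predicate on index lists. [cite: Carlet2020, §2.2.1] -/
def mco (n : ℕ) (g : (Fin n → Bool) → Bool) : List ℕ → Bool := mcoeff n (fun v => g (ForrCode.toInput n v))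

/-- **The bridge.** A cubic `g` is the `gfun` of its binary Möbius coefficients (read through the tree's
`truncOf_eq`): cubic, quadratic and linear masks over the blocks `trips`, `pairs`, `singles`, constant `c_∅`.
[cite: Carlet2020, §2.2.1 (binary Möbius transform)] -/
theorem gfun_of_cubic (g : (Fin n → Bool) → Bool) (hg : IsDegLeFun 3 g) :
    g = gfun n (maskOf (mco n g) (trips n)) (maskOf (mco n g) (pairs n)) (maskOf (mco n g) (singles n)) (mco n g []) := by
  funext x
  have h1 : g x = truncOf n (fun v => g (ForrCode.toInput n v)) x := by rw [truncOf_eq g hg]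
  apply bool_eq_of_bz
  rw [h1, truncOf, cubicMonomials, bz_evalMonos_filter, subsets3_eq]
  simp only [List.map_append, List.sum_append, List.map_cons, List.map_nil, List.sum_cons, List.sum_nil, add_zero]
  rw [gfun, bz_xor, bz_xor, bz_xor, bz_ixval_maskOf, bz_ixval_maskOf, bz_ixval_maskOf]
  have e : monoVal n [] x = true := rfl
  rw [mco, e, if_pos rfl, mul_one]

/-! ### Degree-2 functions have vanishing cubic Möbius coefficients -/

/-- Swapping a list sum with a finite sum. [folklore] -/
theorem list_sum_finset_sum {ι α : Type*} (s : Finset ι) (l : List α) (F : ι → α → ZMod 2) :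
    (l.map fun a => ∑ m ∈ s, F m a).sum = ∑ m ∈ s, (l.map fun a => F m a).sum := by
  induction l with
  | nil => simp
  | cons a l ih => rw [List.map_cons, List.sum_cons, ih, ← Finset.sum_add_distrib]; rfl

/-- **Vanishing of the cubic coefficients in degree `≤ 2`.** For `r` of degree `≤ 2` and an increasing triple
`S`, the Möbius coefficient `⊕_{T ⊆ S} r(1_T)` vanishes: each monomial of a representing polynomial has at most two
variables, and `#{T ⊆ S : A ⊆ T}` is even unless `A = S`. [cite: Carlet2020, §2.2.1] -/
theorem mcoeff_eq_false_of_deg_two (r : (Fin n → Bool) → Bool) (hr : IsDegLeFun 2 r) {S : List ℕ}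
    (hS : S ∈ trips n) : mcoeff n (fun v => r (ForrCode.toInput n v)) S = false := by
  obtain ⟨i, j, l, hij, hjl, hln, rfl⟩ := mem_trips hS
  obtain ⟨p, hp, hrp⟩ := hr
  have hnd : [i, j, l].Nodup := by simp; omega
  have hdec : ∀ v : ZMod 2, (if decide (v = 1) then (1 : ZMod 2) else 0) = v := by decide
  have e : ∀ T : List ℕ, (if r (ForrCode.toInput n (indic n T)) then (1 : ZMod 2) else 0) =
      ∑ m ∈ p.support, p.coeff m * (if (m.support.map Fin.valEmbedding) ⊆ T.toFinset then 1 else 0) := by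
    intro T
    rw [toInput_indic, hrp, polyPhase_apply, hdec, eval_bz]
    refine sum_congr rfl fun m _ => ?_
    congr 1
    refine if_congr ?_ rfl rfl
    simp [Finset.subset_iff, List.mem_toFinset]
  -- 𝔽₂ reading of the coefficient
  have key : (if mcoeff n (fun v => r (ForrCode.toInput n v)) [i, j, l] then (1 : ZMod 2) else 0) = 0 := by
    rw [mcoeff, bz_foldl_xor]
    simp only [Bool.false_eq_true, if_false, zero_add, List.map_map, Function.comp_def]
    rw [show List.take 3 [i, j, l] = [i, j, l] from rfl, List.map_congr_left (fun T _ => e T),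
      list_sum_finset_sum]
    refine Finset.sum_eq_zero fun m hm => ?_
    rw [List.sum_map_mul_left, sum_subInd _ hnd, if_neg, mul_zero]
    intro hEq
    have hc1 : ([i, j, l].toFinset).card = 3 := by rw [List.toFinset_card_of_nodup hnd]; rfl
    have hc2 : (m.support.map Fin.valEmbedding).card ≤ 2 := by
      rw [Finset.card_map]; exact (card_support_le hm).trans hp
    rw [hEq] at hc1
    omega
  revert key
  cases mcoeff n (fun v => r (ForrCode.toInput n v)) [i, j, l] <;> simp





/-! ### The isolation property of a fixed `g` and its behaviour under complement -/

/-- `OK78 g`: every cubic `f` with `Φ(f,g) > 7/8` has `Φ(f,g) = 1`. -/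
def OK78 (g : (Fin n → Bool) → Bool) : Prop :=
  ∀ f : (Fin n → Bool) → Bool, IsDegLeFun 3 f → 7 / 8 < forrelation f g → forrelation f g = 1

/-- Complementing `f` negates `Φ`. [folklore] -/
theorem forrelation_bnot_left (f g : (Fin n → Bool) → Bool) :
    forrelation (fun x => !f x) g = -forrelation f g := by
  unfold forrelation
  simp only [signOf_not, neg_mul, sum_neg_distrib, mul_neg]

/-- Degree is invariant under complement. [cite: Carlet2020, §2.2.1 Def. 6] -/
theorem isDegLeFun_bnot {d : ℕ} {f : (Fin n → Bool) → Bool} (hf : IsDegLeFun d f) :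
    IsDegLeFun d (fun x => !f x) := by
  have e : (fun x => !f x) = fun x => xor (f x) true := funext fun x => by cases f x <;> rfl
  rw [e]
  exact isDegLeFun_xor hf (isDegLeFun_const d true)

/-! ### Affine strip: `Φ(f, g ⊕ ℓ_v ⊕ b) = (−1)^b Φ(f(· ⊕ v), g)` -/

/-- Twisting `g` by a character and a constant: `Φ(f, b ⊕ ℓ ⊕ g) = signOf b · Φ(f(· ⊕ v), g)` when
`(−1)^ℓ = (−1)^{v·}`. [cite: AaronsonAmbainis2018, §1.1.1] -/
theorem forrelation_affine (f g ℓ : (Fin n → Bool) → Bool) (v : Fin n → Bool)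
    (hℓ : ∀ y, signOf (ℓ y) = twist v y) (b : Bool) :
    forrelation f (fun y => xor (xor b (ℓ y)) (g y)) = signOf b * forrelation (fun x => f (bxor x v)) g := by
  unfold forrelation
  rw [mul_left_comm]
  congr 1
  have hinv : Function.Involutive (fun x : Fin n → Bool => bxor x v) := fun x => by
    show bxor (bxor x v) v = x
    rw [bxor_comm (bxor x v), bxor_comm x, bxor_bxor_cancel_left]
  calc ∑ x, ∑ y, signOf (f x) * twist x y * signOf (xor (xor b (ℓ y)) (g y))
      = ∑ x, ∑ y, signOf b * (signOf (f x) * twist (bxor x v) y * signOf (g y)) := by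
        refine sum_congr rfl fun x _ => sum_congr rfl fun y _ => ?_
        rw [signOf_xor, signOf_xor, hℓ, show bxor x v = fun i => x i ^^ v i from rfl, twist_xor_left]
        ring
    _ = signOf b * ∑ x, ∑ y, signOf (f x) * twist (bxor x v) y * signOf (g y) := by
        rw [mul_sum]
        refine sum_congr rfl fun x _ => ?_
        rw [mul_sum]
    _ = signOf b * ∑ x, ∑ y, signOf (f (bxor x v)) * twist x y * signOf (g y) := by
        congr 1
        exact (Equiv.sum_comp (hinv.toPerm _)
          (fun x => ∑ y, signOf (f x) * twist (bxor x v) y * signOf (g y))).symm.trans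
            (sum_congr rfl fun x _ => by simp [hinv x])

/-- Shifting the argument by a constant vector preserves the degree. [cite: Carlet2020, §2.2.1 Def. 6] -/
theorem isDegLeFun_shift {d : ℕ} {f : (Fin n → Bool) → Bool} (hf : IsDegLeFun d f) (v : Fin n → Bool) :
    IsDegLeFun d (fun x => f (bxor x v)) := by
  refine nf_isDegLeFun_subst (fun i => MvPolynomial.X i + MvPolynomial.C (if v i then 1 else 0)) (fun i => ?_)
    (fun x => bxor x v) (fun x i => ?_) hf
  · refine (MvPolynomial.totalDegree_add _ _).trans (max_le ?_ ?_)
    · exact (MvPolynomial.totalDegree_X (R := ZMod 2) i).le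
    · exact (MvPolynomial.totalDegree_C _).le.trans (Nat.zero_le _)
  · have hx : ∀ a b : Bool, (if xor a b then (1 : ZMod 2) else 0) = (if a then (1 : ZMod 2) else 0) + (if b then 1 else 0) := by
      decide
    simp only [bxor, map_add, MvPolynomial.eval_X, MvPolynomial.eval_C]
    exact hx (x i) (v i)

/-- **Affine strip.** `OK78 g → OK78 (b ⊕ ℓ ⊕ g)` for a character `ℓ` and a constant `b`. [folklore] -/
theorem ok78_affine {g ℓ : (Fin n → Bool) → Bool} (hg : OK78 g) (v : Fin n → Bool)
    (hℓ : ∀ y, signOf (ℓ y) = twist v y) (b : Bool) : OK78 (fun y => xor (xor b (ℓ y)) (g y)) := by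
  intro f hf hlt
  rw [forrelation_affine f g ℓ v hℓ b] at hlt ⊢
  have hsh : IsDegLeFun 3 (fun x => f (bxor x v)) := isDegLeFun_shift hf v
  cases b
  · simp only [signOf, Bool.false_eq_true, if_false, one_mul] at hlt ⊢
    exact hg _ hsh hlt
  · simp only [signOf, if_true, neg_mul, one_mul] at hlt ⊢
    have hc : IsDegLeFun 3 (fun x => !f (bxor x v)) := isDegLeFun_bnot hsh
    have e := forrelation_bnot_left (fun x => f (bxor x v)) g
    have h1 : 7 / 8 < forrelation (fun x => !f (bxor x v)) g := by rw [e]; exact hlt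
    rw [← e]
    exact hg _ hc h1


end Summit.QuantumAdvantage.QuantumAdvantage.Theorems.NearExactIsExact.Negative.SmallCases
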